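import Literature.NumberTheory.EllipticCurves.BSDQuadraticDescentTorsionOddPartProofs
import Literature.NumberTheory.EllipticCurves.ComplexMultiplicationBurungaleFlachFiniteProofs
import Literature.NumberTheory.EllipticCurves.BSDInvariantsPositivityProofs
import HarnessLib

/-!
# The `ord_p`-shaped Milne binder `hWR_p`: its shape, its equivalence with `hWR`, and its
# reduction to the odd Tamagawa identity in rank zero over an imaginary quadratic field
# (row T-MIL-ODD, FILE C-4a; seat n1011-p01 GEN 6; lead GO R5-74 (e))

HONEST FRAMING (cell `b2b-bsdres`, run/shared/lean/b2b/bsd-rank1-residual/, verbatim in every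
file): the goal of the cell is to DELETE the COMBINATION-SHAPED residual classes of the
Birch–Swinnerton-Dyer formula for ALL analytic-rank `≤ 1` elliptic curves over `ℚ` — "full BSD
formula for every rank `≤ 1` curve in class `C`" assembled STRICTLY from published theorems — so
that the rank-`≤ 1` remainder becomes exactly the CONSTRUCTION-SHAPED classes, which are TYPED
(missing-input `Prop`s), NOT attempted. This is not "finishing BSD". Sub-classes X3♯(M) / X4(M)
(additive, potentially multiplicative prime; base-change-and-descend): a RESEARCH ROUTE; they stay
CONSTRUCTION-SHAPED; nothing is booked by this file; no mark / label moved. THEOREMS ONLY: no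
definition, no named fact, no `sorry`.

## What (row T-MIL-ODD, `cells/n1011/skel/T-MIL-ODD.md` §6–§7; lead R5-74 (e))

The base-change-and-descend consumers of the cell (`AdditivePotMult/Descent.lean`
`bsdp_of_pPartOver_of_bsdp_twist`, the p04/p16 descent files) take Milne's Weil-restriction
identity as the REAL identity
`hWR : #Ш(W')·Reg(W')·Ω(W')·∏_w c_w(W') / #W'(K)_tors² = RHS(W)·RHS(W_d)` (discharged by the named
fact A65 `Milne1972.bsdQuotient_baseChange_quadratic`), but READ ONLY ITS `p`-ADIC VALUATION (the
`ord_p` bookkeeping of (★)). This TOOL file spells out the `ord_p`-SHAPED binder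

  `hWR_p : ∃ q : ℚ, 0 < q ∧ v_p(q) = 0 ∧ #Ш(W')·Reg(W')·Ω(W')·∏_w c_w(W') / #W'(K)_tors² = q · RHS(W)·RHS(W_d)`

(no definition is introduced: the shape is written out in every statement), and proves:

* `milneQuotient_ordp_of_eq` — `hWR ⇒ hWR_p` at every `p` (`q = 1`): a consumer switching to
  `hWR_p` keeps its A65 discharge verbatim;
* `milneQuotient_eq_of_forall_ordp` — conversely `(∀ p, hWR_p) ⇒ hWR` when `Ш(W)`, `Ш(W_d)` are
  finite (a positive rational with all valuations `0` is `1`, tree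
  `rat_eq_iff_forall_prime_padicValRat_eq`): the family of binders loses nothing;
* `finite_point_of_finite_of_finite_twist` — `W'(K)` finite from `W(ℚ)`, `W_d(ℚ)` finite (tree
  `finite_point_baseChange_of_finite_of_finite_quadraticTwist`, Silverman *AEC* Ex. 10.16);
* `milneQuotient_mul_card_eq`, `milneQuotient_eq_cardRatio_mul` — RANK ZERO over an IMAGINARY
  quadratic `K` (`W'(K)` finite): Milne's quotient IS the explicit positive rational
  `q₀ = (|N_{K/ℚ}(u')|·#Ш(W')·∏c_w(W')·#W(ℚ)²·#W_d(ℚ)²) / (n_W·|u_d|·#Ш(W)·#Ш(W_d)·∏c(W)·∏c(W_d)·#W'(K)²)`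
  times `RHS(W)·RHS(W_d)` — the tree's period elimination (`bsdPeriod_smul'`,
  `realPeriodRat_smul_holds`, `realPeriod_mul_realPeriod_quadraticTwist_eq_mul_bsdPeriod`,
  `Reg = 1`, `#tors = #E(K)`) run as an EQUATION rather than an equivalence;
* `padicValRat_cardRatio_eq_zero_iff` — for odd `p`, `v_p(q₀) = 0` IFF the odd Tamagawa identity
  `v_p(|N(u')|·∏c_w(W')) = v_p(|u_d|·∏c(W)·∏c(W_d))` holds (tree: odd parts of `Ш` and of the
  Mordell–Weil orders balance, `n_W ∈ {1, 2}`); `milneQuotient_ordp_of_tamagawa` — hence `hWR_p`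
  from the Tamagawa identity at `p`;
* the DISCHARGES of `hWR_p` on the populations S₁ (every odd `p`) / S₂ / S₃ (`p ≥ 5`) of this
  row's ENDs (FILES C-3f/C-3g/C-3h) are the next file, C-4b
  (`QuadraticBaseChangeMilneQuotientOddPartDischarge`), one line each from
  `milneQuotient_ordp_of_tamagawa`.

So for the X3♯(M)/X4(M) consumers at the additive prime `p` with `K = ℚ(√−p)` (`p ≡ 3 mod 4`) and
BOTH `W`, `W^{(−p)}` of analytic rank `0`, the binder `hWR_p` at `p` is EXACTLY the odd Tamagawa
identity at `p` (`Ш(W'/K)` finite a hypothesis; A65 not consumed there).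
HONEST LIMITS: the reduction is RANK ZERO and IMAGINARY `K` only — in positive rank Milne's
identity also carries the regulator comparison `Reg(E_K) = 2^r·Reg(E)·Reg(E^{(d)})/[E(K) : E(ℚ)+E^{(d)}(ℚ)]²`
and the odd `Ш`/Selmer comparison with infinite Mordell–Weil groups, neither of which is in the
tree (not attempted; there `hWR_p` is discharged only through A65 by `milneQuotient_ordp_of_eq`);
real quadratic `K` needs the archimedean comparison at two real places (not in the tree);
`Ш(W'/K)` finite is a HYPOTHESIS; odd `p` only (`p = 2` is where Milne's local indices live);
consumers switch binders by THEIR OWN append (lead R5-74 (e)); TOOL theorems; closes no class;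
moves no mark; discharges no named fact.
-/

noncomputable section

open scoped Classical NumberField

open WeierstrassCurve NumberField Literature.NumberTheory.EllipticCurves
  Literature.NumberTheory.QuadraticFields

namespace Summit.BirchSwinnertonDyer.Rank1Residual.AdditivePotMult

/-! ## §1 The binder `hWR_p` against the real identity `hWR` -/

section Binder

variable {K : Type} [Field K] [NumberField K] (W Wd : WeierstrassCurve ℚ) [W.IsElliptic]
  [Wd.IsElliptic] (W' : WeierstrassCurve K)

omit [W.IsElliptic] [Wd.IsElliptic] in
/-- **`hWR ⇒ hWR_p`** at every `p`, with `q = 1`: a consumer that switches its binder from Milne's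
real identity `hWR` to the `ord_p`-shaped `hWR_p` keeps its discharge by the named fact A65
(`Milne1972.bsdQuotient_baseChange_quadratic`) verbatim. [folklore] -/
theorem milneQuotient_ordp_of_eq (p : ℕ)
    (hWR : (W'.shaOrder : ℝ) * W'.regulator * W'.bsdPeriod * (W'.tamagawaProduct : ℝ) /
        (W'.torsionOrder : ℝ) ^ 2 = W.bsdRHS * Wd.bsdRHS) :
    ∃ q : ℚ, 0 < q ∧ padicValRat p q = 0 ∧
      (W'.shaOrder : ℝ) * W'.regulator * W'.bsdPeriod * (W'.tamagawaProduct : ℝ) /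
          (W'.torsionOrder : ℝ) ^ 2 = (q : ℝ) * (W.bsdRHS * Wd.bsdRHS) :=
  ⟨1, one_pos, padicValRat.one, by rw [hWR, Rat.cast_one, one_mul]⟩

/-- **`(∀ p, hWR_p) ⇒ hWR`** when `Ш(W/ℚ)` and `Ш(W_d/ℚ)` are finite (so `RHS(W)·RHS(W_d) > 0`,
tree `bsdRHS_pos'`): all the `q`'s coincide with the one at `p = 2`, which is then a positive
rational with every valuation `0`, i.e. `1` (tree `rat_eq_iff_forall_prime_padicValRat_eq`). The
family of `ord_p`-shaped binders is EQUIVALENT to Milne's identity. [folklore] -/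
theorem milneQuotient_eq_of_forall_ordp (hshaW : W.ShaFinite) (hshaD : Wd.ShaFinite)
    (h : ∀ p : ℕ, p.Prime → ∃ q : ℚ, 0 < q ∧ padicValRat p q = 0 ∧
      (W'.shaOrder : ℝ) * W'.regulator * W'.bsdPeriod * (W'.tamagawaProduct : ℝ) /
          (W'.torsionOrder : ℝ) ^ 2 = (q : ℝ) * (W.bsdRHS * Wd.bsdRHS)) :
    (W'.shaOrder : ℝ) * W'.regulator * W'.bsdPeriod * (W'.tamagawaProduct : ℝ) /
        (W'.torsionOrder : ℝ) ^ 2 = W.bsdRHS * Wd.bsdRHS := by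
  have hB : 0 < W.bsdRHS * Wd.bsdRHS := mul_pos (W.bsdRHS_pos' hshaW) (Wd.bsdRHS_pos' hshaD)
  obtain ⟨q₂, hq₂, -, h₂⟩ := h 2 Nat.prime_two
  have hq : ∀ p : ℕ, p.Prime → padicValRat p q₂ = padicValRat p 1 := by
    intro p hp
    obtain ⟨q, -, hv, hq⟩ := h p hp
    have hqq : (q₂ : ℝ) = q := mul_right_cancel₀ hB.ne' (h₂.symm.trans hq)
    rw [padicValRat.one, ← hv, Rat.cast_injective hqq]
  rw [h₂, (rat_eq_iff_forall_prime_padicValRat_eq hq₂ one_pos).mpr hq, Rat.cast_one, one_mul]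

end Binder

/-! ## §2 Rank zero over an imaginary quadratic field: the quotient is an explicit rational -/

section RankZero

variable (W : WeierstrassCurve ℚ) [W.IsElliptic] (K : Type) [Field K] [NumberField K]
  [IsTotallyComplex K] (Wd : WeierstrassCurve ℚ) [Wd.IsElliptic] (W' : WeierstrassCurve K)
  [W'.IsElliptic]

omit [IsTotallyComplex K] [Wd.IsElliptic] [W'.IsElliptic] in
/-- **`W'(K)` is finite if `W(ℚ)` and `W_d(ℚ)` are** (`[K : ℚ] = 2`, `W_d = C_d • W^{(d_K)}`,
`W' = C' • W_K`): `K = ℚ(θ)`, `θ² = c`, `d_K = c·q²` (tree `Quadratic.exists_sq_eq_algebraMap`,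
`NumberField.exists_discr_eq_mul_sq`), `W^{(c)} ≅ W^{(d_K)} ≅ W_d` over `ℚ`, and the tree's
`finite_point_baseChange_of_finite_of_finite_quadraticTwist` (the finiteness shadow of
`rank E(K) = rank E(ℚ) + rank E^{(c)}(ℚ)`). The rank-zero entry point for consumers holding
`W(ℚ)`, `W_d(ℚ)` finite (Gross–Zagier–Kolyvagin at analytic rank `0`).
[cite: SilvermanAEC2009, Exercise 10.16 and Cor. III.6.4] -/
theorem finite_point_of_finite_of_finite_twist (h2 : Module.finrank ℚ K = 2)
    {Cd : VariableChange ℚ} (hWd : Cd • W.quadraticTwist (NumberField.discr K : ℚ) = Wd)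
    {C' : VariableChange K} (hW' : C' • W.baseChange K = W') [Finite W.toAffine.Point]
    [Finite Wd.toAffine.Point] : Finite W'.toAffine.Point := by
  obtain ⟨θ, c, hθ, hc⟩ := Quadratic.exists_sq_eq_algebraMap (F := ℚ) (K := K) h2
  obtain ⟨q, hq, hd⟩ := NumberField.exists_discr_eq_mul_sq h2 hθ hc
  obtain ⟨C₁, hC₁⟩ := W.exists_variableChange_quadraticTwist_mul_sq c q hq
  have hWd' : (Cd * C₁) • W.quadraticTwist c = Wd := by rw [mul_smul, hC₁, ← hd, hWd]
  haveI : Finite (W.quadraticTwist c).toAffine.Point :=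
    Finite.of_equiv _ ((VariableChange.pointEquiv (W.quadraticTwist c) (Cd * C₁)).trans
      (Affine.Point.congrEquiv hWd')).toEquiv.symm
  haveI : Finite (W.baseChange K).toAffine.Point :=
    W.finite_point_baseChange_of_finite_of_finite_quadraticTwist h2 hθ hc inferInstance
      inferInstance
  exact Finite.of_equiv _ ((VariableChange.pointEquiv (W.baseChange K) C').trans
    (Affine.Point.congrEquiv hW')).toEquiv

/-- **Milne's quotient in RANK ZERO over an IMAGINARY quadratic field, cross-multiplied** (`W/ℚ`
elliptic, `[K : ℚ] = 2`, `K` totally complex, `W_d = C_d • W^{(d_K)}`, `W' = C' • W_K`, `W'(K)`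
finite — hence `W(ℚ)`, `W_d(ℚ)` finite, all regulators `1`, `#tors = #E`):
`[#Ш(W')·Reg(W')·Ω(W')·∏c_w(W')/#W'(K)_tors²] · (n_W·|u_d|·#Ш(W)·#Ш(W_d)·∏c(W)·∏c(W_d)·#W'(K)²)
  = (|N_{K/ℚ}(u')|·#Ш(W')·∏c_w(W')·#W(ℚ)²·#W_d(ℚ)²) · RHS(W)·RHS(W_d)` in `ℝ` — the tree's period
elimination (`bsdPeriod_smul'`: `Ω(C' • W_K) = |N(u')|·Ω(W_K)`; `realPeriodRat_smul_holds`: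
`Ω(C_d • W^{(D)}) = |u_d|·Ω(W^{(D)})`; `realPeriod_mul_realPeriod_quadraticTwist_eq_mul_bsdPeriod`:
`Ω(W)·Ω(W^{(D)}) = n_W·Ω(W_K)`) run as an equation; no finiteness of `Ш` needed (junk `0 = 0`
consistent). [cite: Milne1972ArithmeticAV, §1 Thm. 1 and §2 (through DokchitserDokchitserAnnals2010, §2.1, proof of Thm. 8)] -/
theorem milneQuotient_mul_card_eq (h2 : Module.finrank ℚ K = 2)
    {Cd : VariableChange ℚ} (hWd : Cd • W.quadraticTwist (NumberField.discr K : ℚ) = Wd)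
    {C' : VariableChange K} (hW' : C' • W.baseChange K = W') [Finite W'.toAffine.Point] :
    (W'.shaOrder : ℝ) * W'.regulator * W'.bsdPeriod * (W'.tamagawaProduct : ℝ) /
          (W'.torsionOrder : ℝ) ^ 2 *
        (((W.baseChange ℝ).numRealComponents * |(Cd.u : ℚ)| * W.shaOrder * Wd.shaOrder *
          W.tamagawaProduct * Wd.tamagawaProduct * (Nat.card W'.toAffine.Point) ^ 2 : ℚ) : ℝ) =
      ((|Algebra.norm ℚ (C'.u : K)| * W'.shaOrder * W'.tamagawaProduct *
          (Nat.card W.toAffine.Point) ^ 2 * (Nat.card Wd.toAffine.Point) ^ 2 : ℚ) : ℝ) *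
        (W.bsdRHS * Wd.bsdRHS) := by
  haveI hfinQ : Finite W.toAffine.Point := finite_point_of_finite_point_smul_baseChange W K hW'
  haveI hfinD : Finite Wd.toAffine.Point :=
    finite_point_twist_of_finite_point_smul_baseChange W K h2 hWd hW'
  have hD : (NumberField.discr K : ℚ) ≠ 0 := by exact_mod_cast NumberField.discr_ne_zero K
  haveI := W.isElliptic_quadraticTwist hD
  subst hWd hW'
  haveI hEK : (W.baseChange K).IsElliptic := by rw [baseChange]; infer_instance
  set P : ℝ := (W.baseChange K).bsdPeriod with hP_def
  have hP : 0 < P := bsdPeriod_pos' _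
  have hP' : (C' • W.baseChange K).bsdPeriod = ((|Algebra.norm ℚ (C'.u : K)| : ℚ) : ℝ) * P :=
    (W.baseChange K).bsdPeriod_smul' C'
  have hΩd : (Cd • W.quadraticTwist (NumberField.discr K : ℚ)).realPeriodRat =
      |((Cd.u : ℚ) : ℝ)| * (W.quadraticTwist (NumberField.discr K : ℚ)).realPeriodRat :=
    (W.quadraticTwist (NumberField.discr K : ℚ)).realPeriodRat_smul_holds Cd
  have hA5 : W.realPeriodRat * (W.quadraticTwist (NumberField.discr K : ℚ)).realPeriodRat =
      ((W.baseChange ℝ).numRealComponents : ℝ) * P :=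
    realPeriod_mul_realPeriod_quadraticTwist_eq_mul_bsdPeriod W K h2
  have hN' : (Nat.card (C' • W.baseChange K).toAffine.Point : ℝ) ≠ 0 := by
    exact_mod_cast (Nat.card_pos (α := (C' • W.baseChange K).toAffine.Point)).ne'
  have hN : (Nat.card W.toAffine.Point : ℝ) ≠ 0 := by
    exact_mod_cast (Nat.card_pos (α := W.toAffine.Point)).ne'
  have hNd : (Nat.card (Cd • W.quadraticTwist (NumberField.discr K : ℚ)).toAffine.Point : ℝ) ≠ 0 := by
    exact_mod_cast
      (Nat.card_pos (α := (Cd • W.quadraticTwist (NumberField.discr K : ℚ)).toAffine.Point)).ne'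
  rw [W.bsdRHS_eq_of_finite, (Cd • W.quadraticTwist (NumberField.discr K : ℚ)).bsdRHS_eq_of_finite,
    (C' • W.baseChange K).regulator_eq_one_of_finite,
    (C' • W.baseChange K).torsionOrder_eq_natCard_of_finite, hP', hΩd, div_mul_div_comm,
    ← mul_div_assoc, div_mul_eq_mul_div,
    div_eq_div_iff (pow_ne_zero 2 hN') (mul_ne_zero (pow_ne_zero 2 hN) (pow_ne_zero 2 hNd))]
  push_cast
  linear_combination (-(((C' • W.baseChange K).shaOrder : ℝ) *
    |((Algebra.norm ℚ (C'.u : K) : ℚ) : ℝ)| * ((C' • W.baseChange K).tamagawaProduct : ℝ) *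
    |((Cd.u : ℚ) : ℝ)| * (W.shaOrder : ℝ) *
    ((Cd • W.quadraticTwist (NumberField.discr K : ℚ)).shaOrder : ℝ) * (W.tamagawaProduct : ℝ) *
    ((Cd • W.quadraticTwist (NumberField.discr K : ℚ)).tamagawaProduct : ℝ) *
    (Nat.card (C' • W.baseChange K).toAffine.Point : ℝ) ^ 2 * (Nat.card W.toAffine.Point : ℝ) ^ 2 *
    (Nat.card (Cd • W.quadraticTwist (NumberField.discr K : ℚ)).toAffine.Point : ℝ) ^ 2)) * hA5

/-- **Milne's quotient in rank zero over an imaginary quadratic field IS the explicit rational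
`q₀ = (|N(u')|·#Ш(W')·∏c_w(W')·#W(ℚ)²·#W_d(ℚ)²)/(n_W·|u_d|·#Ш(W)·#Ш(W_d)·∏c(W)·∏c(W_d)·#W'(K)²)`
times `RHS(W)·RHS(W_d)`** (with `Ш(W'/K)` finite, so that `Ш(W)`, `Ш(W_d)` are finite and the
denominator is non-zero; previous theorem). [cite: Milne1972ArithmeticAV, §1 Thm. 1 and §2 (through DokchitserDokchitserAnnals2010, §2.1, proof of Thm. 8)] -/
theorem milneQuotient_eq_cardRatio_mul (h2 : Module.finrank ℚ K = 2)
    {Cd : VariableChange ℚ} (hWd : Cd • W.quadraticTwist (NumberField.discr K : ℚ) = Wd)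
    {C' : VariableChange K} (hW' : C' • W.baseChange K = W') [Finite W'.toAffine.Point]
    (hsha : W'.ShaFinite) :
    (W'.shaOrder : ℝ) * W'.regulator * W'.bsdPeriod * (W'.tamagawaProduct : ℝ) /
          (W'.torsionOrder : ℝ) ^ 2 =
      (((|Algebra.norm ℚ (C'.u : K)| * W'.shaOrder * W'.tamagawaProduct *
            (Nat.card W.toAffine.Point) ^ 2 * (Nat.card Wd.toAffine.Point) ^ 2) /
          ((W.baseChange ℝ).numRealComponents * |(Cd.u : ℚ)| * W.shaOrder * Wd.shaOrder *
            W.tamagawaProduct * Wd.tamagawaProduct * (Nat.card W'.toAffine.Point) ^ 2) : ℚ) : ℝ) *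
        (W.bsdRHS * Wd.bsdRHS) := by
  have hshaQ : W.ShaFinite := W.shaFinite_of_shaFinite_smul_baseChange K hW' hsha
  have hshaD : Wd.ShaFinite := W.shaFinite_twist_of_shaFinite_smul_baseChange K h2 hWd hW' hsha
  have h := milneQuotient_mul_card_eq W K Wd W' h2 hWd hW'
  have hB0 : (((W.baseChange ℝ).numRealComponents * |(Cd.u : ℚ)| * W.shaOrder * Wd.shaOrder *
      W.tamagawaProduct * Wd.tamagawaProduct * (Nat.card W'.toAffine.Point) ^ 2 : ℚ) : ℝ) ≠ 0 := by
    have hn0 : 0 < (W.baseChange ℝ).numRealComponents := (W.baseChange ℝ).numRealComponents_pos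
    have hud : (Cd.u : ℚ) ≠ 0 := (Cd.u).ne_zero
    have hS0 : 0 < W.shaOrder := W.shaOrder_pos hshaQ
    have hSd0 : 0 < Wd.shaOrder := Wd.shaOrder_pos hshaD
    have hT0 : 0 < W.tamagawaProduct := W.tamagawaProduct_pos'
    have hTd0 : 0 < Wd.tamagawaProduct := Wd.tamagawaProduct_pos'
    have hN'0 : 0 < Nat.card W'.toAffine.Point := Nat.card_pos
    have : ((W.baseChange ℝ).numRealComponents * |(Cd.u : ℚ)| * W.shaOrder * Wd.shaOrder *
        W.tamagawaProduct * Wd.tamagawaProduct * (Nat.card W'.toAffine.Point) ^ 2 : ℚ) ≠ 0 := by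
      have hb : (|(Cd.u : ℚ)| : ℚ) ≠ 0 := abs_ne_zero.mpr hud
      positivity
    exact_mod_cast this
  rw [Rat.cast_div, div_mul_eq_mul_div, eq_div_iff hB0, ← h]

omit [IsTotallyComplex K] in
/-- **At an odd prime `p`, `v_p(q₀) = 0` IFF the odd Tamagawa identity holds** (`W'(K)`, `Ш(W'/K)`
finite; any quadratic `K`): `v_p(q₀) = v_p(numerator) − v_p(denominator)`, and at odd `p` the
`Ш`-orders (tree `padicValNat_shaOrder_baseChange_quadratic_of_odd`) and the Mordell–Weil orders
(tree `padicValNat_natCard_point_baseChange_quadratic_of_odd`, Silverman *AEC* Ex. 10.16) balance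
while `n_W ∈ {1, 2}` is a `p`-adic unit; what is left is
`v_p(|N(u')|·∏c_w(W')) = v_p(|u_d|·∏c(W)·∏c(W_d))` — the body of `hodd`, this row's ENDs. The
pointwise-in-`p` form of the tree's `card_identity_iff_padicValRat`.
[cite: Milne1972ArithmeticAV, §1 Thm. 1 and §2 (through DokchitserDokchitserAnnals2010, §2.1, proof of Thm. 8 and Lemma 4.14)] -/
theorem padicValRat_cardRatio_eq_zero_iff (h2 : Module.finrank ℚ K = 2)
    {Cd : VariableChange ℚ} (hWd : Cd • W.quadraticTwist (NumberField.discr K : ℚ) = Wd)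
    {C' : VariableChange K} (hW' : C' • W.baseChange K = W') [Finite W'.toAffine.Point]
    (hsha : W'.ShaFinite) (p : ℕ) [hp : Fact p.Prime] (hp2 : p ≠ 2) :
    padicValRat p (((|Algebra.norm ℚ (C'.u : K)| * W'.shaOrder * W'.tamagawaProduct *
            (Nat.card W.toAffine.Point) ^ 2 * (Nat.card Wd.toAffine.Point) ^ 2) /
          ((W.baseChange ℝ).numRealComponents * |(Cd.u : ℚ)| * W.shaOrder * Wd.shaOrder *
            W.tamagawaProduct * Wd.tamagawaProduct * (Nat.card W'.toAffine.Point) ^ 2) : ℚ)) = 0 ↔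
      padicValRat p (|Algebra.norm ℚ (C'.u : K)| * W'.tamagawaProduct : ℚ) =
        padicValRat p (|(Cd.u : ℚ)| * (W.tamagawaProduct * Wd.tamagawaProduct) : ℚ) := by
  haveI hfinQ : Finite W.toAffine.Point := finite_point_of_finite_point_smul_baseChange W K hW'
  haveI hfinD : Finite Wd.toAffine.Point :=
    finite_point_twist_of_finite_point_smul_baseChange W K h2 hWd hW'
  have hshaQ : W.ShaFinite := W.shaFinite_of_shaFinite_smul_baseChange K hW' hsha
  have hshaD : Wd.ShaFinite := W.shaFinite_twist_of_shaFinite_smul_baseChange K h2 hWd hW' hsha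
  have hnorm : Algebra.norm ℚ (C'.u : K) ≠ 0 := Algebra.norm_ne_zero_iff.mpr (C'.u).ne_zero
  have hud : (Cd.u : ℚ) ≠ 0 := (Cd.u).ne_zero
  have hS'0 : 0 < W'.shaOrder := W'.shaOrder_pos hsha
  have hS0 : 0 < W.shaOrder := W.shaOrder_pos hshaQ
  have hSd0 : 0 < Wd.shaOrder := Wd.shaOrder_pos hshaD
  have hT'0 : 0 < W'.tamagawaProduct := W'.tamagawaProduct_pos'
  have hT0 : 0 < W.tamagawaProduct := W.tamagawaProduct_pos'
  have hTd0 : 0 < Wd.tamagawaProduct := Wd.tamagawaProduct_pos'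
  have hN'0 : 0 < Nat.card W'.toAffine.Point := Nat.card_pos
  have hN0 : 0 < Nat.card W.toAffine.Point := Nat.card_pos
  have hNd0 : 0 < Nat.card Wd.toAffine.Point := Nat.card_pos
  have hn0 : 0 < (W.baseChange ℝ).numRealComponents := (W.baseChange ℝ).numRealComponents_pos
  have ha : (|Algebra.norm ℚ (C'.u : K)| : ℚ) ≠ 0 := abs_ne_zero.mpr hnorm
  have hb : (|(Cd.u : ℚ)| : ℚ) ≠ 0 := abs_ne_zero.mpr hud
  have hS' : (W'.shaOrder : ℚ) ≠ 0 := by exact_mod_cast hS'0.ne'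
  have hS : (W.shaOrder : ℚ) ≠ 0 := by exact_mod_cast hS0.ne'
  have hSd : (Wd.shaOrder : ℚ) ≠ 0 := by exact_mod_cast hSd0.ne'
  have hT' : (W'.tamagawaProduct : ℚ) ≠ 0 := by exact_mod_cast hT'0.ne'
  have hT : (W.tamagawaProduct : ℚ) ≠ 0 := by exact_mod_cast hT0.ne'
  have hTd : (Wd.tamagawaProduct : ℚ) ≠ 0 := by exact_mod_cast hTd0.ne'
  have hN' : (Nat.card W'.toAffine.Point : ℚ) ≠ 0 := by exact_mod_cast hN'0.ne'
  have hN : (Nat.card W.toAffine.Point : ℚ) ≠ 0 := by exact_mod_cast hN0.ne'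
  have hNd : (Nat.card Wd.toAffine.Point : ℚ) ≠ 0 := by exact_mod_cast hNd0.ne'
  have hn : ((W.baseChange ℝ).numRealComponents : ℚ) ≠ 0 := by exact_mod_cast hn0.ne'
  -- the `Ш`- and Mordell–Weil orders balance at `p`
  obtain ⟨θ, c, hθ, hc⟩ := Quadratic.exists_sq_eq_algebraMap (F := ℚ) (K := K) h2
  obtain ⟨q, hq, hd⟩ := NumberField.exists_discr_eq_mul_sq h2 hθ hc
  have hMW : (padicValNat p (Nat.card W'.toAffine.Point) : ℤ) =
      padicValNat p (Nat.card W.toAffine.Point) + padicValNat p (Nat.card Wd.toAffine.Point) := by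
    exact_mod_cast W.padicValNat_natCard_point_baseChange_quadratic_of_odd h2 hθ hc hq hd
      ⟨Cd, hWd⟩ ⟨C', hW'⟩ p hp2
  have hSha : (padicValNat p W'.shaOrder : ℤ) =
      padicValNat p W.shaOrder + padicValNat p Wd.shaOrder := by
    exact_mod_cast W.padicValNat_shaOrder_baseChange_quadratic_of_odd K h2 hWd hW' hsha p hp2
  -- `n_W ∈ {1, 2}` is a `p`-adic unit
  have hnv : padicValRat p ((W.baseChange ℝ).numRealComponents : ℚ) = 0 := by
    rw [numRealComponents_baseChange_real]
    split_ifs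
    · haveI : Fact (Nat.Prime 2) := ⟨Nat.prime_two⟩
      rw [padicValRat.of_nat, padicValNat_primes hp2, Nat.cast_zero]
    · rw [Nat.cast_one, padicValRat.one]
  have hA : (|Algebra.norm ℚ (C'.u : K)| * W'.shaOrder * W'.tamagawaProduct *
      (Nat.card W.toAffine.Point) ^ 2 * (Nat.card Wd.toAffine.Point) ^ 2 : ℚ) ≠ 0 :=
    mul_ne_zero (mul_ne_zero (mul_ne_zero (mul_ne_zero ha hS') hT') (pow_ne_zero 2 hN))
      (pow_ne_zero 2 hNd)
  have hB : ((W.baseChange ℝ).numRealComponents * |(Cd.u : ℚ)| * W.shaOrder * Wd.shaOrder *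
      W.tamagawaProduct * Wd.tamagawaProduct * (Nat.card W'.toAffine.Point) ^ 2 : ℚ) ≠ 0 :=
    mul_ne_zero (mul_ne_zero (mul_ne_zero (mul_ne_zero (mul_ne_zero (mul_ne_zero hn hb) hS)
      hSd) hT) hTd) (pow_ne_zero 2 hN')
  rw [padicValRat.div hA hB, sub_eq_zero,
    padicValRat.mul (mul_ne_zero (mul_ne_zero (mul_ne_zero ha hS') hT') (pow_ne_zero 2 hN))
      (pow_ne_zero 2 hNd),
    padicValRat.mul (mul_ne_zero (mul_ne_zero ha hS') hT') (pow_ne_zero 2 hN),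
    padicValRat.mul (mul_ne_zero ha hS') hT', padicValRat.mul ha hS',
    padicValRat.mul (mul_ne_zero (mul_ne_zero (mul_ne_zero (mul_ne_zero (mul_ne_zero hn hb) hS)
      hSd) hT) hTd) (pow_ne_zero 2 hN'),
    padicValRat.mul (mul_ne_zero (mul_ne_zero (mul_ne_zero (mul_ne_zero hn hb) hS) hSd) hT) hTd,
    padicValRat.mul (mul_ne_zero (mul_ne_zero (mul_ne_zero hn hb) hS) hSd) hT,
    padicValRat.mul (mul_ne_zero (mul_ne_zero hn hb) hS) hSd,
    padicValRat.mul (mul_ne_zero hn hb) hS, padicValRat.mul hn hb,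
    padicValRat.mul ha hT', padicValRat.mul hb (mul_ne_zero hT hTd), padicValRat.mul hT hTd,
    padicValRat.pow, padicValRat.pow, padicValRat.pow, hnv,
    padicValRat.of_nat, padicValRat.of_nat, padicValRat.of_nat, padicValRat.of_nat,
    padicValRat.of_nat, padicValRat.of_nat, padicValRat.of_nat, padicValRat.of_nat,
    padicValRat.of_nat]
  constructor
  · intro h
    linear_combination h - hSha + 2 * hMW
  · intro h
    linear_combination h + hSha - 2 * hMW

/-- **`hWR_p` from the odd Tamagawa identity at `p`, rank zero, imaginary `K`** (`W'(K)` and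
`Ш(W'/K)` finite, `p` odd): `q = q₀ > 0`, `v_p(q₀) = 0` by `padicValRat_cardRatio_eq_zero_iff`, and
the identity by `milneQuotient_eq_cardRatio_mul`. The schema the three discharges below instantiate.
[cite: Milne1972ArithmeticAV, §1 Thm. 1 and §2 (through DokchitserDokchitserAnnals2010, §2.1, proof of Thm. 8)] -/
theorem milneQuotient_ordp_of_tamagawa (h2 : Module.finrank ℚ K = 2)
    {Cd : VariableChange ℚ} (hWd : Cd • W.quadraticTwist (NumberField.discr K : ℚ) = Wd)
    {C' : VariableChange K} (hW' : C' • W.baseChange K = W') [Finite W'.toAffine.Point]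
    (hsha : W'.ShaFinite) (p : ℕ) [hp : Fact p.Prime] (hp2 : p ≠ 2)
    (hT : padicValRat p (|Algebra.norm ℚ (C'.u : K)| * W'.tamagawaProduct : ℚ) =
      padicValRat p (|(Cd.u : ℚ)| * (W.tamagawaProduct * Wd.tamagawaProduct) : ℚ)) :
    ∃ q : ℚ, 0 < q ∧ padicValRat p q = 0 ∧
      (W'.shaOrder : ℝ) * W'.regulator * W'.bsdPeriod * (W'.tamagawaProduct : ℝ) /
          (W'.torsionOrder : ℝ) ^ 2 = (q : ℝ) * (W.bsdRHS * Wd.bsdRHS) := by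
  haveI hfinQ : Finite W.toAffine.Point := finite_point_of_finite_point_smul_baseChange W K hW'
  haveI hfinD : Finite Wd.toAffine.Point :=
    finite_point_twist_of_finite_point_smul_baseChange W K h2 hWd hW'
  have hshaQ : W.ShaFinite := W.shaFinite_of_shaFinite_smul_baseChange K hW' hsha
  have hshaD : Wd.ShaFinite := W.shaFinite_twist_of_shaFinite_smul_baseChange K h2 hWd hW' hsha
  refine ⟨_, ?_, (padicValRat_cardRatio_eq_zero_iff W K Wd W' h2 hWd hW' hsha p hp2).mpr hT,
    milneQuotient_eq_cardRatio_mul W K Wd W' h2 hWd hW' hsha⟩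
  have hnorm : Algebra.norm ℚ (C'.u : K) ≠ 0 := Algebra.norm_ne_zero_iff.mpr (C'.u).ne_zero
  have hud : (Cd.u : ℚ) ≠ 0 := (Cd.u).ne_zero
  have ha : 0 < (|Algebra.norm ℚ (C'.u : K)| : ℚ) := abs_pos.mpr hnorm
  have hb : 0 < (|(Cd.u : ℚ)| : ℚ) := abs_pos.mpr hud
  have hS'0 : 0 < W'.shaOrder := W'.shaOrder_pos hsha
  have hS0 : 0 < W.shaOrder := W.shaOrder_pos hshaQ
  have hSd0 : 0 < Wd.shaOrder := Wd.shaOrder_pos hshaD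
  have hT'0 : 0 < W'.tamagawaProduct := W'.tamagawaProduct_pos'
  have hT0 : 0 < W.tamagawaProduct := W.tamagawaProduct_pos'
  have hTd0 : 0 < Wd.tamagawaProduct := Wd.tamagawaProduct_pos'
  have hN'0 : 0 < Nat.card W'.toAffine.Point := Nat.card_pos
  have hN0 : 0 < Nat.card W.toAffine.Point := Nat.card_pos
  have hNd0 : 0 < Nat.card Wd.toAffine.Point := Nat.card_pos
  have hn0 : 0 < (W.baseChange ℝ).numRealComponents := (W.baseChange ℝ).numRealComponents_pos
  positivity

end RankZero

end Summit.BirchSwinnertonDyer.Rank1Residual.AdditivePotMult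

end
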